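import Summits.CriticalPhenomena.PercolationContinuityZ3.Theorems.Transplant.CayleyCylinderKit
import HarnessLib

/-!
# Cylinders of a Cayley-graph skeleton IV — corner-admissible kernel words (letters-only 2-step nilpotent groups)

builds on p205010 (kernel theorem, internal audit signed; external expert review pending) — nothing in this file uses p205010.
Lane `prim-bschramm`, seat `prim-bschramm-p4` gen 10 (PART C3 of `P4-GENERAL.md`, "tier 2″").  Helper file
(`--supports stmt-CriticalPhenomena-4575 --as helper`).

`CylData` (file `CayleyCylinderWalks`) asks that `ker φ` be generated by the kernel LETTERS of `S`; for the letters-only Cayley graph of a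
2-step nilpotent group (`fnGraph m`: `S = {e_i^{±1}}`) this fails — the commutators `[e₁,e₂], [e₁,e_j], [e₂,e_j]` are needed.  This file
introduces the weaker datum `CylData₁`: `S` symmetric and, for each sign `σ = ±1`, `ker φ` generated by the kernel letters together with the
CORNER-ADMISSIBLE commutator words `a⁻¹ b⁻¹ a b` (`a, b ∈ S`, `φ a ≠ φ b ∈ {0, e₀, σ e₁}`), whose `φ`-paths `0, −φa, −φa−φb, −φb, 0` stay in
the inward unit square `{0,−1} × {0,−σ}` of the corner `(ℓ+1, σ(ℓ+1))` of a cylinder and never join two deep points `(−1,−σ)`.  Main output: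
for every `k ∈ ker φ` a walk `admWalk σ k : 1 → k` in `Cay(Γ;S)` with these two properties (`admWalk_good`), by closure induction
(products = concatenation of left translates, inverses = reversed translates); the enlarged letter set `Sp ⊇ S` (adding the admissible
commutators) carries an honest `CylData` (`enl`), through which all `φ`-bookkeeping of files I–III is reused; the direction letter `t σ = s₁^{σ}`.
-/

noncomputable section

namespace Summit.CriticalPhenomena.PercolationContinuityZ3.Theorems.Transplant

namespace CayCyl

open SimpleGraph Walk Literature.Probability.LatticeModels Literature.Probability.Percolation
open scoped Classical

variable {Γ : Type} [Group Γ] {S : Finset Γ}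

/-! ## §1 Admissible offsets and admissible generators -/

/-- Admissible offset at a corner of sign `σ`: `y ∈ {0,−1} × {0,−σ}`. [folklore] -/
def AdmV (σ : ℤ) (y : Site 2) : Prop := (y 0 = 0 ∨ y 0 = -1) ∧ (y 1 = 0 ∨ y 1 = -σ)

/-- The deep offset `(−1, −σ)` (the only admissible offset inside the small cylinder). [folklore] -/
def Deep (σ : ℤ) (y : Site 2) : Prop := y 0 = -1 ∧ y 1 = -σ

/-- The three letter heights allowed in an admissible pair: `0`, `e₀`, `σ e₁`. [folklore] -/
def Dir (σ : ℤ) (y : Site 2) : Prop := y = 0 ∨ y = Pi.single 0 1 ∨ y = σ • Pi.single 1 1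

/-- **Admissible generators of sign `σ`**: kernel letters, and `a⁻¹ b⁻¹ a b` for letters `a, b` of distinct heights in `{0, e₀, σ e₁}`. [folklore] -/
def admGen (φ : Γ → Site 2) (S : Finset Γ) (σ : ℤ) : Set Γ :=
  {k | k ∈ S ∧ φ k = 0} ∪ {k | ∃ a ∈ S, ∃ b ∈ S, Dir σ (φ a) ∧ Dir σ (φ b) ∧ φ a ≠ φ b ∧ k = a⁻¹ * b⁻¹ * a * b}

/-- `0` is admissible. [folklore] -/
theorem admV_zero (σ : ℤ) : AdmV σ (0 : Site 2) := ⟨Or.inl rfl, Or.inl rfl⟩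
/-- `0` is not deep. [folklore] -/
theorem not_deep_zero (σ : ℤ) : ¬Deep σ (0 : Site 2) := fun h => by simpa using h.1

/-- Minus a direction is admissible (`σ = ±1`). [folklore] -/
theorem admV_neg_of_dir {σ : ℤ} {y : Site 2} (h : Dir σ y) : AdmV σ (-y) := by
  rcases h with rfl | rfl | rfl
  · exact ⟨Or.inl (by simp), Or.inl (by simp)⟩
  · exact ⟨Or.inr (by simp), Or.inl (by simp)⟩
  · exact ⟨Or.inl (by simp), Or.inr (by simp)⟩

/-- Minus a direction is not deep (`σ = ±1`). [folklore] -/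
theorem not_deep_neg_of_dir {σ : ℤ} (hσ : σ = 1 ∨ σ = -1) {y : Site 2} (h : Dir σ y) : ¬Deep σ (-y) := by
  rintro ⟨h0, h1⟩
  rcases h with rfl | rfl | rfl
  · simp at h0
  · simp at h1; rcases hσ with rfl | rfl <;> simp at h1
  · simp at h0

/-- Minus the sum of two distinct directions is admissible (`σ = ±1`). [folklore] -/
theorem admV_neg_add_of_dir {σ : ℤ} {y z : Site 2} (hy : Dir σ y) (hz : Dir σ z) (hne : y ≠ z) : AdmV σ (-y - z) := by
  rcases hy with rfl | rfl | rfl <;> rcases hz with rfl | rfl | rfl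
  · exact absurd rfl hne
  · exact ⟨Or.inr (by simp), Or.inl (by simp)⟩
  · exact ⟨Or.inl (by simp), Or.inr (by simp)⟩
  · exact ⟨Or.inr (by simp), Or.inl (by simp)⟩
  · exact absurd rfl hne
  · exact ⟨Or.inr (by simp), Or.inr (by simp)⟩
  · exact ⟨Or.inl (by simp), Or.inr (by simp)⟩
  · exact ⟨Or.inr (by simp), Or.inr (by simp)⟩
  · exact absurd rfl hne

/-! ## §2 The datum -/

/-- **CYLINDER DATA WITH CORNER-ADMISSIBLE KERNEL**: as `CylData` but with `S` symmetric and, for each sign `σ = ±1`, `ker φ` generated by the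
admissible generators of sign `σ` (instead of by kernel letters alone). [cite: KozmaNitzan2024, §4 p. 16 (Lemma 8)] [cite: BenjaminiSchramm1996, §2] -/
structure CylData₁ (Γ : Type) [Group Γ] (S : Finset Γ) where
  /-- the skeleton homomorphism -/
  φ : Γ → Site 2
  /-- additivity -/
  map_mul : ∀ g h : Γ, φ (g * h) = φ g + φ h
  /-- generators have sup-norm `≤ 1` -/
  lip : ∀ s ∈ S, ∀ i : Fin 2, |φ s i| ≤ 1
  /-- the unit step in direction `0` -/
  s₀ : Γ
  /-- it is a generator -/
  s₀_mem : s₀ ∈ S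
  /-- its height -/
  φ_s₀ : φ s₀ = Pi.single 0 1
  /-- the unit step in direction `1` -/
  s₁ : Γ
  /-- it is a generator -/
  s₁_mem : s₁ ∈ S
  /-- its height -/
  φ_s₁ : φ s₁ = Pi.single 1 1
  /-- `S` is symmetric -/
  inv_mem : ∀ s ∈ S, s⁻¹ ∈ S
  /-- the kernel is generated by the admissible generators of each sign -/
  ker_adm : ∀ σ : ℤ, σ = 1 ∨ σ = -1 → ∀ k : Γ, φ k = 0 → k ∈ Subgroup.closure (admGen φ S σ)

namespace CylData₁

variable (D : CylData₁ Γ S)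

/-- The admissible commutators as a finite set. [folklore] -/
def admFin (σ : ℤ) : Finset Γ :=
  ((S ×ˢ S).filter fun p => Dir σ (D.φ p.1) ∧ Dir σ (D.φ p.2) ∧ D.φ p.1 ≠ D.φ p.2).image fun p => p.1⁻¹ * p.2⁻¹ * p.1 * p.2

/-- Membership in `admFin`. [folklore] -/
theorem mem_admFin {σ : ℤ} {k : Γ} :
    k ∈ D.admFin σ ↔ ∃ a ∈ S, ∃ b ∈ S, Dir σ (D.φ a) ∧ Dir σ (D.φ b) ∧ D.φ a ≠ D.φ b ∧ k = a⁻¹ * b⁻¹ * a * b := by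
  simp only [admFin, Finset.mem_image, Finset.mem_filter, Finset.mem_product, Prod.exists]
  constructor
  · rintro ⟨a, b, ⟨⟨ha, hb⟩, h1, h2, h3⟩, rfl⟩; exact ⟨a, ha, b, hb, h1, h2, h3, rfl⟩
  · rintro ⟨a, ha, b, hb, h1, h2, h3, rfl⟩; exact ⟨a, b, ⟨⟨ha, hb⟩, h1, h2, h3⟩, rfl⟩

/-- **The enlarged letter set** `S⁺ = S ∪ {admissible commutators of both signs}`. [folklore] -/
def Sp : Finset Γ := S ∪ D.admFin 1 ∪ D.admFin (-1)

/-- `S ⊆ S⁺`. [folklore] -/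
theorem subset_Sp : S ⊆ D.Sp := fun _ h => Finset.mem_union_left _ (Finset.mem_union_left _ h)
/-- `φ` of a commutator word `a⁻¹ b⁻¹ a b` vanishes. [folklore] -/
theorem φ_comm_word (a b : Γ) : D.φ (a⁻¹ * b⁻¹ * a * b) = 0 := by
  have hi : ∀ g : Γ, D.φ g⁻¹ = -D.φ g := fun g => by
    have h := D.map_mul g g⁻¹
    have h1 : D.φ 1 = 0 := by have := D.map_mul 1 1; rw [one_mul] at this; exact left_eq_add.1 this
    rw [mul_inv_cancel, h1] at h; exact (neg_eq_of_add_eq_zero_right h.symm).symm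
  rw [D.map_mul, D.map_mul, D.map_mul, hi, hi]; abel

/-- Admissible generators lie in the kernel. [folklore] -/
theorem φ_eq_zero_of_mem_admGen {σ : ℤ} {k : Γ} (hk : k ∈ admGen D.φ S σ) : D.φ k = 0 := by
  rcases hk with ⟨-, h⟩ | ⟨a, -, b, -, -, -, -, rfl⟩
  · exact h
  · exact D.φ_comm_word a b

/-- **The enlarged datum is a `CylData`** (kernel letters of `S⁺` generate `ker φ`). [folklore] -/
def enl : CylData Γ D.Sp where
  φ := D.φ
  map_mul := D.map_mul
  lip := fun s hs i => by
    rcases Finset.mem_union.1 hs with hs | hs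
    · rcases Finset.mem_union.1 hs with hs | hs
      · exact D.lip s hs i
      · obtain ⟨a, -, b, -, -, -, -, rfl⟩ := D.mem_admFin.1 hs
        rw [D.φ_comm_word]; simp
    · obtain ⟨a, -, b, -, -, -, -, rfl⟩ := D.mem_admFin.1 hs
      rw [D.φ_comm_word]; simp
  s₀ := D.s₀
  s₀_mem := D.subset_Sp D.s₀_mem
  φ_s₀ := D.φ_s₀
  s₁ := D.s₁
  s₁_mem := D.subset_Sp D.s₁_mem
  φ_s₁ := D.φ_s₁
  ker_gen := fun k hk => by
    refine (Subgroup.closure_mono ?_) (D.ker_adm 1 (Or.inl rfl) k hk)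
    rintro g (⟨hg, h0⟩ | ⟨a, ha, b, hb, h1, h2, h3, rfl⟩)
    · exact Finset.mem_coe.2 (Finset.mem_filter.2 ⟨D.subset_Sp hg, h0⟩)
    · exact Finset.mem_coe.2 (Finset.mem_filter.2
        ⟨Finset.mem_union_left _ (Finset.mem_union_right _ (D.mem_admFin.2 ⟨a, ha, b, hb, h1, h2, h3, rfl⟩)), D.φ_comm_word a b⟩)

/-- `enl.φ = φ`. [folklore] -/
@[simp] theorem enl_φ : D.enl.φ = D.φ := rfl

/-- Edges of `Cay(Γ;S)` are edges of `Cay(Γ;S⁺)`. [folklore] -/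
theorem adj_Sp {u v : Γ} (h : (mulCayley (S : Set Γ)).Adj u v) : (mulCayley (D.Sp : Set Γ)).Adj u v := by
  rw [mulCayley_adj] at h ⊢
  obtain ⟨hne, h | h⟩ := h
  · exact ⟨hne, Or.inl (Finset.mem_coe.2 (D.subset_Sp (Finset.mem_coe.1 h)))⟩
  · exact ⟨hne, Or.inr (Finset.mem_coe.2 (D.subset_Sp (Finset.mem_coe.1 h)))⟩

/-! ## §3 The direction letter `t σ = s₁^{σ}` -/

/-- The direction letter: `s₁` for `σ = 1`, `s₁⁻¹` otherwise. [folklore] -/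
def t (σ : ℤ) : Γ := if σ = 1 then D.s₁ else D.s₁⁻¹

/-- `t σ ∈ S`. [folklore] -/
theorem t_mem (σ : ℤ) : D.t σ ∈ S := by
  unfold t; split_ifs
  · exact D.s₁_mem
  · exact D.inv_mem _ D.s₁_mem

/-- `φ (t σ) = σ e₁` for `σ = ±1`. [folklore] -/
theorem φ_t {σ : ℤ} (hσ : σ = 1 ∨ σ = -1) : D.φ (D.t σ) = σ • Pi.single 1 1 := by
  unfold t
  rcases hσ with rfl | rfl
  · rw [if_pos rfl, D.φ_s₁, one_smul]
  · rw [if_neg (by norm_num), show D.φ D.s₁⁻¹ = -D.φ D.s₁ from D.enl.φ_inv D.s₁, D.φ_s₁, neg_smul, one_smul]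

/-- `t σ ≠ 1`. [folklore] -/
theorem t_ne_one (σ : ℤ) : D.t σ ≠ 1 := by
  unfold t; split_ifs <;> [exact D.enl.s₁_ne_one; exact inv_ne_one.2 D.enl.s₁_ne_one]

/-- Steps by `t σ` are edges. [folklore] -/
theorem adj_t (σ : ℤ) (g : Γ) : (mulCayley (S : Set Γ)).Adj g (g * D.t σ) := adj_mul_of_mem S (Or.inl (D.t_mem σ)) (D.t_ne_one σ) g
/-- Steps by `(t σ)⁻¹` are edges. [folklore] -/
theorem adj_t_inv (σ : ℤ) (g : Γ) : (mulCayley (S : Set Γ)).Adj g (g * (D.t σ)⁻¹) :=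
  adj_mul_of_mem S (Or.inl (D.inv_mem _ (D.t_mem σ))) (inv_ne_one.2 (D.t_ne_one σ)) g

/-- Coordinates along `t σ`-rows. [folklore] -/
theorem φ_t_pow {σ : ℤ} (hσ : σ = 1 ∨ σ = -1) (g : Γ) (i : ℕ) :
    D.φ (g * D.t σ ^ i) 0 = D.φ g 0 ∧ D.φ (g * D.t σ ^ i) 1 = D.φ g 1 + σ * i := by
  have h := D.enl.φ_pow (D.t σ) i
  rw [enl_φ] at h
  rw [D.map_mul, h, D.φ_t hσ]
  refine ⟨by simp, ?_⟩
  simp [mul_comm]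

/-- Coordinates along `(t σ)⁻¹`-rows. [folklore] -/
theorem φ_t_inv_pow {σ : ℤ} (hσ : σ = 1 ∨ σ = -1) (g : Γ) (i : ℕ) :
    D.φ (g * (D.t σ)⁻¹ ^ i) 0 = D.φ g 0 ∧ D.φ (g * (D.t σ)⁻¹ ^ i) 1 = D.φ g 1 - σ * i := by
  have h := D.enl.φ_pow (D.t σ)⁻¹ i
  rw [enl_φ, show D.φ (D.t σ)⁻¹ = -D.φ (D.t σ) from D.enl.φ_inv _] at h
  rw [D.map_mul, h, D.φ_t hσ]
  refine ⟨by simp, ?_⟩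
  simp [mul_comm, sub_eq_add_neg]

/-- Powers of `t σ` are distinct. [folklore] -/
theorem t_pow_injective {σ : ℤ} (hσ : σ = 1 ∨ σ = -1) (i j : ℕ) (h : D.t σ ^ i = D.t σ ^ j) : i = j := by
  have h1 := congrArg (fun g => D.φ (1 * g) 1) h
  simp only [(D.φ_t_pow hσ 1 _).2] at h1
  rcases hσ with rfl | rfl <;> simp at h1 <;> exact_mod_cast h1

/-- Powers of `(t σ)⁻¹` are distinct. [folklore] -/
theorem t_inv_pow_injective {σ : ℤ} (hσ : σ = 1 ∨ σ = -1) (i j : ℕ) (h : (D.t σ)⁻¹ ^ i = (D.t σ)⁻¹ ^ j) : i = j :=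
  D.t_pow_injective hσ i j (by rw [inv_pow, inv_pow] at h; exact inv_injective h)

/-! ## §4 Admissible kernel walks -/

/-- A walk is GOOD at base `c` for sign `σ`: all vertices at admissible offsets from `φ c`, no dart between two deep vertices. [folklore] -/
def Good (σ : ℤ) (c : Γ) {u v : Γ} (w : (mulCayley (S : Set Γ)).Walk u v) : Prop :=
  (∀ z ∈ w.support, AdmV σ (D.φ z - D.φ c)) ∧
    ∀ d ∈ w.darts, ¬(Deep σ (D.φ d.fst - D.φ c) ∧ Deep σ (D.φ d.snd - D.φ c))

/-- Goodness is preserved by left translation (with the base point translated). [folklore] -/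
theorem good_lmul {σ : ℤ} {c u v : Γ} (g : Γ) {w : (mulCayley (S : Set Γ)).Walk u v} (hw : D.Good σ c w) :
    D.Good σ (g * c) (lmul S g w) := by
  have key : ∀ z : Γ, D.φ (g * z) - D.φ (g * c) = D.φ z - D.φ c := fun z => by rw [D.map_mul, D.map_mul]; abel
  refine ⟨fun z hz => ?_, fun d hd => ?_⟩
  · obtain ⟨z', hz', rfl⟩ := mem_support_lmul.1 hz
    rw [key]; exact hw.1 z' hz'
  · induction w with
    | nil => simp [lmul] at hd
    | @cons a b _ h p ih =>
      rw [lmul, darts_cons, List.mem_cons] at hd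
      rcases hd with rfl | hd
      · have := hw.2 ⟨(a, b), h⟩ (by simp)
        simpa only [key] using this
      · exact ih ⟨fun z hz => hw.1 z (by rw [support_cons]; exact List.mem_cons_of_mem _ hz),
          fun d' hd' => hw.2 d' (by rw [darts_cons]; exact List.mem_cons_of_mem _ hd')⟩ hd

/-- Goodness of an appended walk. [folklore] -/
theorem good_append {σ : ℤ} {c u v x : Γ} {w₁ : (mulCayley (S : Set Γ)).Walk u v} {w₂ : (mulCayley (S : Set Γ)).Walk v x}
    (h₁ : D.Good σ c w₁) (h₂ : D.Good σ c w₂) : D.Good σ c (w₁.append w₂) := by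
  refine ⟨fun z hz => ?_, fun d hd => ?_⟩
  · rw [support_append, List.mem_append] at hz
    rcases hz with hz | hz
    · exact h₁.1 z hz
    · exact h₂.1 z (List.tail_subset _ hz)
  · rw [darts_append, List.mem_append] at hd
    rcases hd with hd | hd
    · exact h₁.2 d hd
    · exact h₂.2 d hd

/-- Goodness of a reversed walk. [folklore] -/
theorem good_reverse {σ : ℤ} {c u v : Γ} {w : (mulCayley (S : Set Γ)).Walk u v} (h : D.Good σ c w) : D.Good σ c w.reverse := by
  refine ⟨fun z hz => h.1 z ((mem_support_reverse_iff w z).1 hz), fun d hd => ?_⟩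
  rw [mem_darts_reverse] at hd
  have := h.2 _ hd
  intro hc; exact this ⟨hc.2, hc.1⟩

/-- Goodness of a copied walk. [folklore] -/
theorem good_copy {σ : ℤ} {c u v u' v' : Γ} {w : (mulCayley (S : Set Γ)).Walk u v} (hu : u = u') (hv : v = v') (h : D.Good σ c w) :
    D.Good σ c (w.copy hu hv) := by subst hu hv; exact h

/-- Goodness with respect to a base point of the same height. [folklore] -/
theorem good_congr_base {σ : ℤ} {c c' u v : Γ} {w : (mulCayley (S : Set Γ)).Walk u v} (hc : D.φ c = D.φ c') (h : D.Good σ c w) :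
    D.Good σ c' w := by
  refine ⟨fun z hz => ?_, fun d hd => ?_⟩
  · rw [← hc]; exact h.1 z hz
  · rw [← hc]; exact h.2 d hd

/-- The 4-step commutator walk `1 → a⁻¹ → a⁻¹b⁻¹ → a⁻¹b⁻¹a → a⁻¹b⁻¹ab` (for letters `a, b ≠ 1`). [folklore] -/
def commWalk {a b : Γ} (ha : a ∈ S) (hb : b ∈ S) (ha1 : a ≠ 1) (hb1 : b ≠ 1) :
    (mulCayley (S : Set Γ)).Walk (1 : Γ) (a⁻¹ * b⁻¹ * a * b) :=
  Walk.cons (adj_mul_of_mem S (Or.inr (by rw [inv_inv]; exact ha)) (inv_ne_one.2 ha1) 1)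
    (Walk.cons (adj_mul_of_mem S (Or.inr (by rw [inv_inv]; exact hb)) (inv_ne_one.2 hb1) (1 * a⁻¹))
      (Walk.cons (adj_mul_of_mem S (Or.inl ha) ha1 (1 * a⁻¹ * b⁻¹))
        ((Walk.cons (adj_mul_of_mem S (Or.inl hb) hb1 (1 * a⁻¹ * b⁻¹ * a)) Walk.nil).copy rfl (by group))))

/-- The commutator walk of an admissible pair is good (`σ = ±1`). [folklore] -/
theorem good_commWalk {σ : ℤ} (hσ : σ = 1 ∨ σ = -1) {a b : Γ} (ha : a ∈ S) (hb : b ∈ S) (ha1 : a ≠ 1) (hb1 : b ≠ 1)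
    (hda : Dir σ (D.φ a)) (hdb : Dir σ (D.φ b)) (hne : D.φ a ≠ D.φ b) : D.Good σ 1 (commWalk ha hb ha1 hb1) := by
  have h1 : D.φ 1 = 0 := D.enl.φ_one
  have hi : ∀ g : Γ, D.φ g⁻¹ = -D.φ g := fun g => D.enl.φ_inv g
  have e1 : D.φ (1 * a⁻¹) - D.φ 1 = -D.φ a := by rw [one_mul, hi, h1, sub_zero]
  have e2 : D.φ (1 * a⁻¹ * b⁻¹) - D.φ 1 = -D.φ a - D.φ b := by rw [one_mul, D.map_mul, hi, hi, h1]; abel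
  have e3 : D.φ (1 * a⁻¹ * b⁻¹ * a) - D.φ 1 = -D.φ b := by rw [one_mul, D.map_mul, D.map_mul, hi, hi, h1]; abel
  have e4 : D.φ (1 * a⁻¹ * b⁻¹ * a * b) - D.φ 1 = 0 := by rw [one_mul, D.φ_comm_word, h1, sub_zero]
  have e0 : D.φ 1 - D.φ 1 = 0 := sub_self _
  have nda := not_deep_neg_of_dir hσ hda; have ndb := not_deep_neg_of_dir hσ hdb
  refine ⟨fun z hz => ?_, fun d hd => ?_⟩
  · simp only [commWalk, support_cons, support_copy, support_nil, List.mem_cons, List.not_mem_nil, or_false] at hz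
    rcases hz with rfl | rfl | rfl | rfl | rfl
    · rw [e0]; exact admV_zero σ
    · rw [e1]; exact admV_neg_of_dir hda
    · rw [e2]; exact admV_neg_add_of_dir hda hdb hne
    · rw [e3]; exact admV_neg_of_dir hdb
    · rw [e4]; exact admV_zero σ
  · simp only [commWalk, darts_cons, darts_copy, darts_nil, List.mem_cons, List.not_mem_nil, or_false] at hd
    rcases hd with rfl | rfl | rfl | rfl
    · rintro ⟨h, -⟩; rw [show D.φ (1 : Γ) - D.φ 1 = 0 from e0] at h; exact not_deep_zero σ h
    · rintro ⟨h, -⟩; exact nda (e1 ▸ h)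
    · rintro ⟨-, h⟩; exact ndb (e3 ▸ h)
    · rintro ⟨h, -⟩; exact ndb (e3 ▸ h)

/-- **ADMISSIBLE KERNEL WALKS**: every `k ∈ ker φ` is joined to `1` by a good walk of sign `σ`. [folklore] -/
theorem exists_admWalk {σ : ℤ} (hσ : σ = 1 ∨ σ = -1) (k : Γ) (hk : D.φ k = 0) :
    ∃ w : (mulCayley (S : Set Γ)).Walk (1 : Γ) k, D.Good σ 1 w := by
  have h1 : D.φ 1 = 0 := D.enl.φ_one
  suffices H : ∀ g ∈ Subgroup.closure (admGen D.φ S σ), D.φ g = 0 ∧ ∃ w : (mulCayley (S : Set Γ)).Walk (1 : Γ) g, D.Good σ 1 w from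
    (H k (D.ker_adm σ hσ k hk)).2
  intro g hg
  induction hg using Subgroup.closure_induction with
  | mem x hx =>
      refine ⟨D.φ_eq_zero_of_mem_admGen hx, ?_⟩
      rcases hx with ⟨hxS, hx0⟩ | ⟨a, ha, b, hb, hda, hdb, hne, rfl⟩
      · by_cases hx1 : x = 1
        · subst hx1; exact ⟨Walk.nil, fun z hz => by simp at hz; subst hz; rw [sub_self]; exact admV_zero σ, fun d hd => by simp at hd⟩
        · refine ⟨(Walk.cons (adj_mul_of_mem S (Or.inl hxS) hx1 1) Walk.nil).copy rfl (one_mul x), fun z hz => ?_, fun d hd => ?_⟩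
          · simp only [support_copy, support_cons, support_nil, List.mem_cons, List.not_mem_nil, or_false] at hz
            rcases hz with rfl | rfl
            · rw [sub_self]; exact admV_zero σ
            · rw [one_mul, h1, sub_zero, hx0]; exact admV_zero σ
          · simp only [darts_copy, darts_cons, darts_nil, List.mem_cons, List.not_mem_nil, or_false] at hd
            subst hd; rintro ⟨h, -⟩; rw [sub_self] at h; exact not_deep_zero σ h
      · have triv : ∀ g : Γ, g = 1 → ∃ w : (mulCayley (S : Set Γ)).Walk (1 : Γ) g, D.Good σ 1 w := by
          rintro _ rfl
          exact ⟨Walk.nil, fun z hz => by simp at hz; subst hz; rw [sub_self]; exact admV_zero σ, fun d hd => by simp at hd⟩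
        by_cases ha1 : a = 1
        · exact triv _ (by subst ha1; group)
        by_cases hb1 : b = 1
        · exact triv _ (by subst hb1; group)
        exact ⟨commWalk ha hb ha1 hb1, D.good_commWalk hσ ha hb ha1 hb1 hda hdb hne⟩
  | one => exact ⟨h1, Walk.nil, fun z hz => by simp at hz; subst hz; rw [sub_self]; exact admV_zero σ, fun d hd => by simp at hd⟩
  | mul x y _ _ hx hy =>
      obtain ⟨hx0, wx, hwx⟩ := hx
      obtain ⟨hy0, wy, hwy⟩ := hy
      refine ⟨by rw [D.map_mul, hx0, hy0, add_zero], wx.append ((lmul S x wy).copy (mul_one x) rfl), ?_⟩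
      refine D.good_append hwx (D.good_copy _ _ ?_)
      exact D.good_congr_base (by rw [mul_one, hx0, h1]) (D.good_lmul x hwy)
  | inv x _ hx =>
      obtain ⟨hx0, wx, hwx⟩ := hx
      have hx0' : D.φ x⁻¹ = 0 := by rw [show D.φ x⁻¹ = -D.φ x from D.enl.φ_inv x, hx0, neg_zero]
      refine ⟨hx0', (lmul S x⁻¹ wx.reverse).copy (inv_mul_cancel x) (mul_one x⁻¹), ?_⟩
      refine D.good_copy _ _ ?_
      exact D.good_congr_base (by rw [mul_one, hx0', h1]) (D.good_lmul x⁻¹ (D.good_reverse hwx))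

/-- A chosen admissible kernel walk (for `σ = ±1`; the empty default is never used). [folklore] -/
def admWalk {σ : ℤ} (hσ : σ = 1 ∨ σ = -1) (k : Γ) (hk : D.φ k = 0) : (mulCayley (S : Set Γ)).Walk (1 : Γ) k :=
  Classical.choose (D.exists_admWalk hσ k hk)

/-- The chosen admissible walk is good. [folklore] -/
theorem admWalk_good {σ : ℤ} (hσ : σ = 1 ∨ σ = -1) (k : Γ) (hk : D.φ k = 0) : D.Good σ 1 (D.admWalk hσ k hk) :=
  Classical.choose_spec (D.exists_admWalk hσ k hk)

/-- The length of the chosen admissible walk (`0` off the kernel or off `σ = ±1`). [folklore] -/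
def admLen (σ : ℤ) (k : Γ) : ℕ :=
  if h : (σ = 1 ∨ σ = -1) ∧ D.φ k = 0 then (D.admWalk h.1 k h.2).length else 0

/-- `admLen` is the length of `admWalk`. [folklore] -/
theorem length_admWalk {σ : ℤ} (hσ : σ = 1 ∨ σ = -1) (k : Γ) (hk : D.φ k = 0) : (D.admWalk hσ k hk).length = D.admLen σ k := by
  rw [admLen, dif_pos ⟨hσ, hk⟩]

end CylData₁

end CayCyl

end Summit.CriticalPhenomena.PercolationContinuityZ3.Theorems.Transplant

end
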